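import Summits.QuantumAdvantage.QuantumAdvantage.Theses.SpinorFlattening
import Literature.Computability.QuantumComplexity.GaussianRank
import Literature.Computability.QuantumComplexity.StabilizerSimulationMagicT

/-!
# `NegApproxGaussRankSuperpoly` (stmt-QuantumAdvantage-1245) — negative side I: LOAD-BEARING analysis,
tightness of the constant, refuted strengthenings

Support / negative lemmas for the crux
`Summit.QuantumAdvantage.QuantumAdvantage.Theses.SpinorFlattening.NegApproxGaussRankSuperpoly`
(superpolynomial constant-precision approximate Gaussian rank of `|M⟩^{⊗t}`), extracted from the
refuter work file `Summits/QuantumAdvantage/QuantumAdvantage/Cruxes/NegApproxGaussRankSuperpoly/Disproof.lean`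
(refuter-cdisprove-stmt-QuantumAdvantage-1245-0, generation 1, 2026-08-16) so that provers, planners
and ideators can IMPORT them.  Sorry-free; nothing here asserts a Theses statement positively.

* §0 `crux_iff_named` — the crux is, by `Iff.rfl`, the named-API statement over
  `IsGaussian` / `magicMPow` / `normSq` (GaussianRank.lean); every variant below edits ONE token.
* §1 toolkit — `normSq_magicMPow` (‖M^{⊗t}‖² = 1), `magicMPow_ne_zero`, the exact `2^{4t}`-term
  Gaussian decomposition `magicMPow_eq_sum_basis`, the two-term decomposition at `t = 1`
  (`magicMPow_one_eq`, χ_G(M) ≤ 2), `one_le_budget`, `isGaussian_zero_qubits`.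
* §2 LOAD-BEARING (drop one hypothesis ⇒ false): `false_without_rankBound`,
  `false_without_gaussianity`, `false_without_linearIndependence`, `false_without_annihilation`
  ⇒ any proof uses the budget AND the annihilator structure of the dictionary.
* §3 TIGHTNESS: `not_inner_of_one_le` (for `δ ≥ 1` the inner claim fails at `r = 0` for every
  `c, t`; so `δ < 1` is forced and "every δ < 1" is best possible), `not_atDeltaOne`,
  `no_witness_t_zero`, `no_witness_t_one` (the crux prover's `t` is never `0`, nor `1` when `c ≥ 1`).
* §4 STRENGTHENINGS REFUTED: `not_uniformT` (`∃ t ∀ c`), `not_allPosT` (`∀ c ∀ t > 0`).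
-/

noncomputable section

set_option linter.dupNamespace false -- D-0017: single-conjunct summit ⇒ `QuantumAdvantage.QuantumAdvantage` by design

namespace Summit.QuantumAdvantage.QuantumAdvantage.Theorems.NegApproxGaussRankSuperpoly.Negative

open Literature.Computability.Cryptography Literature.Computability.QuantumComplexity Matrix Finset
open Summit.QuantumAdvantage.QuantumAdvantage.Theses.SpinorFlattening (NegApproxGaussRankSuperpoly)

/-! ## §0 The crux over the named API -/

/-- The crux is LITERALLY (by `Iff.rfl`) the named-API statement: the route's inline `maj`,
`IsGauss`, `Mpow` unfold to `majorana`, `IsGaussian`, `magicMPow`. [folklore] -/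
theorem crux_iff_named : NegApproxGaussRankSuperpoly ↔
    (∃ δ : ℝ, 0 < δ ∧ δ < 1 ∧ ∀ c : ℕ, ∃ t : ℕ, ∀ r : ℕ, r ≤ t ^ c + c →
      ∀ (a : Fin r → ℂ) (g : Fin r → QReg (t * 4) → ℂ), (∀ i, IsGaussian (g i)) →
        δ ^ 2 < normSq (magicMPow t - ∑ i, a i • g i)) :=
  Iff.rfl

/-! ## §1 Toolkit -/

/-- `‖0‖² = 0`. [folklore] -/
theorem normSq_zero_vec (n : ℕ) : normSq (0 : QReg n → ℂ) = 0 := by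
  simp [normSq]

/-- The amplitude of `|M⟩^{⊗t}` on a constant bit string is `(√2)^{-t}`. [folklore] -/
theorem magicMPow_apply_const (t : ℕ) (b : Bool) :
    magicMPow t (fun _ => b) = ((Real.sqrt 2 : ℂ)⁻¹) ^ t := by
  classical
  rw [magicMPow_apply, if_pos (fun _ _ => rfl)]

/-- `|M⟩^{⊗t} ≠ 0`. [folklore] -/
theorem magicMPow_ne_zero (t : ℕ) : magicMPow t ≠ 0 := by
  intro h
  have h1 := congrFun h (fun _ => false)
  rw [magicMPow_apply_const, Pi.zero_apply] at h1
  exact pow_ne_zero _ (inv_ne_zero (Complex.ofReal_ne_zero.2 (Real.sqrt_ne_zero'.2 two_pos))) h1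

/-- `‖ |M⟩^{⊗t} ‖² = 1` (tensor recursion `magicMPow_succ` and multiplicativity of the norm).
[folklore] -/
theorem normSq_magicMPow (t : ℕ) : normSq (magicMPow t) = 1 := by
  induction t with
  | zero =>
    rw [magicMPow_zero]
    simp [normSq]
  | succ t ih =>
    have key : normSq (magicMPow (t + 1)) = normSq (tensorVec (magicMPow t) magicM) := by
      unfold normSq
      refine Fintype.sum_equiv ⟨fun x m => x (Fin.cast (add_one_mul t 4).symm m),
        fun z j => z (Fin.cast (add_one_mul t 4) j), fun x => ?_, fun z => ?_⟩ _ _ (fun x => ?_)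
      · funext j; simp
      · funext m; simp
      · rw [magicMPow_succ]
        rfl
    rw [key, normSq_tensorVec, ih, normSq_magicM, one_mul]

/-- EXACT `2^{4t}`-TERM GAUSSIAN DECOMPOSITION: `|M⟩^{⊗t} = Σ_x M^{⊗t}(x) |x⟩` over the
computational basis (every `|x⟩` is Gaussian, `basisState_isGaussian`), indexed by `Fin (2^{4t})`.
So the exact Gaussian rank is `≤ 2^{4t}` (indeed `≤ 2^t`, not needed here). [folklore] -/
theorem magicMPow_eq_sum_basis (t : ℕ) :
    ∃ e : QReg (t * 4) ≃ Fin (2 ^ (t * 4)), magicMPow t =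
      ∑ i : Fin (2 ^ (t * 4)), magicMPow t (e.symm i) • basisState (e.symm i) := by
  have hcard : Fintype.card (QReg (t * 4)) = 2 ^ (t * 4) := by simp
  refine ⟨Fintype.equivFinOfCardEq hcard, ?_⟩
  set e := Fintype.equivFinOfCardEq hcard
  calc magicMPow t = ∑ x, magicMPow t x • basisState x :=
        state_eq_sum_amplitude_smul_basisState _
    _ = _ := (Equiv.sum_comp e.symm (fun x => magicMPow t x • basisState x)).symm

/-- TWO-TERM DECOMPOSITION AT `t = 1`: `|M⟩ = (√2)⁻¹ |0000⟩ + (√2)⁻¹ |1111⟩` — two Gaussian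
(basis) states, so `χ_G(M) ≤ 2`. [cite: CudbyStrelchuk2023, §6 (χ_G(|M⟩) = 2)] -/
theorem magicMPow_one_eq :
    (magicMPow 1 : QReg (1 * 4) → ℂ) =
      ∑ i : Fin 2, (fun _ : Fin 2 => ((Real.sqrt 2 : ℂ)⁻¹)) i •
        (![basisState (fun _ => false), basisState (fun _ => true)] :
          Fin 2 → QReg (1 * 4) → ℂ) i := by
  funext x
  rw [magicMPow_one x]
  simp [magicM, Fin.sum_univ_two, Finset.sum_apply, mul_add]

/-- The budget `t^c + c` is always at least `1` (so `r = 1` is always admissible). [folklore] -/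
theorem one_le_budget (t c : ℕ) : 1 ≤ t ^ c + c := by
  rcases c with _ | k
  · simp
  · have : 0 ≤ t ^ (k + 1) := Nat.zero_le _
    omega

/-- On `0` qubits every nonzero amplitude is Gaussian (no annihilator is asked for). [folklore] -/
theorem isGaussian_zero_qubits (ψ : QReg 0 → ℂ) (h : ψ ≠ 0) : IsGaussian ψ :=
  ⟨h, fun k => k.elim0, linearIndependent_empty_type, fun k => k.elim0⟩

/-- The standard `n` independent coefficient rows `A k p = [p.1 = k]` (used to show that the
annihilation equations, not the mere existence of independent rows, carry the content). [folklore] -/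
theorem linearIndependent_rows (n : ℕ) :
    LinearIndependent ℂ (fun (k : Fin n) (p : Fin n × Bool) => if p.1 = k then (1 : ℂ) else 0) := by
  rw [Fintype.linearIndependent_iff]
  intro g hg k
  have h := congrFun hg (k, false)
  simp only [Finset.sum_apply, Pi.smul_apply, smul_eq_mul, Pi.zero_apply] at h
  simpa using h

/-! ## §2 LOAD-BEARING hypotheses: drop one ⇒ false -/

/-- LOAD-BEARING (budget): without `r ≤ t^c + c` the statement is false — the `2^{4t}` computational
basis states decompose `|M⟩^{⊗t}` exactly. [folklore] -/
theorem false_without_rankBound :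
    ¬ (∃ δ : ℝ, 0 < δ ∧ δ < 1 ∧ ∀ c : ℕ, ∃ t : ℕ, ∀ r : ℕ,
        ∀ (a : Fin r → ℂ) (g : Fin r → QReg (t * 4) → ℂ), (∀ i, IsGaussian (g i)) →
          δ ^ 2 < normSq (magicMPow t - ∑ i, a i • g i)) := by
  rintro ⟨δ, -, -, h⟩
  obtain ⟨t, ht⟩ := h 0
  obtain ⟨e, he⟩ := magicMPow_eq_sum_basis t
  have key := ht (2 ^ (t * 4)) (fun i => magicMPow t (e.symm i)) (fun i => basisState (e.symm i))
    (fun i => basisState_isGaussian _)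
  rw [← he, sub_self, normSq_zero_vec] at key
  exact absurd key (not_lt.2 (sq_nonneg δ))

/-- LOAD-BEARING (dictionary): if any nonzero vector counts, `|M⟩^{⊗t}` itself is one term
(`r = 1 ≤ t^c + c` always). [folklore] -/
theorem false_without_gaussianity :
    ¬ (∃ δ : ℝ, 0 < δ ∧ δ < 1 ∧ ∀ c : ℕ, ∃ t : ℕ, ∀ r : ℕ, r ≤ t ^ c + c →
        ∀ (a : Fin r → ℂ) (g : Fin r → QReg (t * 4) → ℂ), (∀ i, g i ≠ 0) →
          δ ^ 2 < normSq (magicMPow t - ∑ i, a i • g i)) := by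
  rintro ⟨δ, -, -, h⟩
  obtain ⟨t, ht⟩ := h 0
  have key := ht 1 (one_le_budget t 0) (fun _ => 1) (fun _ => magicMPow t)
    (fun _ => magicMPow_ne_zero t)
  rw [Fin.sum_univ_one, one_smul, sub_self, normSq_zero_vec] at key
  exact absurd key (not_lt.2 (sq_nonneg δ))

/-- LOAD-BEARING (independence of the annihilators): with `A = 0` allowed, every nonzero vector is
"Gaussian", in particular `|M⟩^{⊗t}`. [folklore] -/
theorem false_without_linearIndependence :
    ¬ (∃ δ : ℝ, 0 < δ ∧ δ < 1 ∧ ∀ c : ℕ, ∃ t : ℕ, ∀ r : ℕ, r ≤ t ^ c + c →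
        ∀ (a : Fin r → ℂ) (g : Fin r → QReg (t * 4) → ℂ),
          (∀ i, g i ≠ 0 ∧ ∃ A : Fin (t * 4) → (Fin (t * 4) × Bool → ℂ),
            ∀ k, (∑ p : Fin (t * 4) × Bool, A k p • majorana (t * 4) p.1 p.2) *ᵥ g i = 0) →
          δ ^ 2 < normSq (magicMPow t - ∑ i, a i • g i)) := by
  rintro ⟨δ, -, -, h⟩
  obtain ⟨t, ht⟩ := h 0
  have key := ht 1 (one_le_budget t 0) (fun _ => 1) (fun _ => magicMPow t)
    (fun _ => ⟨magicMPow_ne_zero t, fun _ _ => 0, fun k => by simp⟩)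
  rw [Fin.sum_univ_one, one_smul, sub_self, normSq_zero_vec] at key
  exact absurd key (not_lt.2 (sq_nonneg δ))

/-- LOAD-BEARING (the annihilation equations): independent rows always exist, so again every
nonzero vector would count. [folklore] -/
theorem false_without_annihilation :
    ¬ (∃ δ : ℝ, 0 < δ ∧ δ < 1 ∧ ∀ c : ℕ, ∃ t : ℕ, ∀ r : ℕ, r ≤ t ^ c + c →
        ∀ (a : Fin r → ℂ) (g : Fin r → QReg (t * 4) → ℂ),
          (∀ i, g i ≠ 0 ∧ ∃ A : Fin (t * 4) → (Fin (t * 4) × Bool → ℂ), LinearIndependent ℂ A) →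
          δ ^ 2 < normSq (magicMPow t - ∑ i, a i • g i)) := by
  rintro ⟨δ, -, -, h⟩
  obtain ⟨t, ht⟩ := h 0
  have key := ht 1 (one_le_budget t 0) (fun _ => 1) (fun _ => magicMPow t)
    (fun _ => ⟨magicMPow_ne_zero t, _, linearIndependent_rows (t * 4)⟩)
  rw [Fin.sum_univ_one, one_smul, sub_self, normSq_zero_vec] at key
  exact absurd key (not_lt.2 (sq_nonneg δ))

/-! ## §3 TIGHTNESS of the constant and excluded witnesses -/

/-- TIGHT AT `δ = 1`: for `δ ≥ 1` the inner claim fails for EVERY `c` and EVERY `t`, already at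
`r = 0` (the empty combination is at squared distance exactly `‖M^{⊗t}‖² = 1`).  So the crux's
side condition `δ < 1` is forced, and "every `δ < 1`" (what the line proves) is best possible.
[folklore] -/
theorem not_inner_of_one_le (δ : ℝ) (hδ : 1 ≤ δ) (c t : ℕ) :
    ¬ (∀ r : ℕ, r ≤ t ^ c + c → ∀ (a : Fin r → ℂ) (g : Fin r → QReg (t * 4) → ℂ),
        (∀ i, IsGaussian (g i)) → δ ^ 2 < normSq (magicMPow t - ∑ i, a i • g i)) := by
  intro h
  have key := h 0 (Nat.zero_le _) Fin.elim0 Fin.elim0 (fun i => i.elim0)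
  rw [Finset.univ_eq_empty, Finset.sum_empty, sub_zero, normSq_magicMPow] at key
  nlinarith

/-- `δ = 1` is impossible. [folklore] -/
theorem not_atDeltaOne :
    ¬ (∀ c : ℕ, ∃ t : ℕ, ∀ r : ℕ, r ≤ t ^ c + c →
        ∀ (a : Fin r → ℂ) (g : Fin r → QReg (t * 4) → ℂ), (∀ i, IsGaussian (g i)) →
          (1 : ℝ) ^ 2 < normSq (magicMPow t - ∑ i, a i • g i)) := by
  intro h
  obtain ⟨t, ht⟩ := h 0
  exact not_inner_of_one_le 1 le_rfl 0 t ht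

/-- EXCLUDED WITNESS `t = 0`: on zero qubits the dictionary is all of `ℂ^×`, so the crux prover's
`t` is never `0` (for any `δ > 0` and any `c`). [folklore] -/
theorem no_witness_t_zero (δ : ℝ) (c : ℕ) :
    ¬ (∀ r : ℕ, r ≤ 0 ^ c + c → ∀ (a : Fin r → ℂ) (g : Fin r → QReg (0 * 4) → ℂ),
        (∀ i, IsGaussian (g i)) → δ ^ 2 < normSq (magicMPow 0 - ∑ i, a i • g i)) := by
  intro h
  have key := h 1 (one_le_budget 0 c) (fun _ => 1) (fun _ => magicMPow 0)
    (fun _ => isGaussian_zero_qubits _ (magicMPow_ne_zero 0))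
  rw [Fin.sum_univ_one, one_smul, sub_self, normSq_zero_vec] at key
  exact absurd key (not_lt.2 (sq_nonneg δ))

/-- EXCLUDED WITNESS `t = 1` (for `c ≥ 1`): `χ_G(M) ≤ 2 ≤ 1^c + c`. [folklore] -/
theorem no_witness_t_one (δ : ℝ) (c : ℕ) (hc : 1 ≤ c) :
    ¬ (∀ r : ℕ, r ≤ 1 ^ c + c → ∀ (a : Fin r → ℂ) (g : Fin r → QReg (1 * 4) → ℂ),
        (∀ i, IsGaussian (g i)) → δ ^ 2 < normSq (magicMPow 1 - ∑ i, a i • g i)) := by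
  intro h
  have key := h 2 (by rw [one_pow]; omega) (fun _ => ((Real.sqrt 2 : ℂ)⁻¹))
    ![basisState (fun _ => false), basisState (fun _ => true)]
    (fun i => by fin_cases i <;> exact basisState_isGaussian _)
  rw [← magicMPow_one_eq, sub_self, normSq_zero_vec] at key
  exact absurd key (not_lt.2 (sq_nonneg δ))

/-! ## §4 NATURAL STRENGTHENINGS refuted -/

/-- `∃ t ∀ c` is false: at fixed `t` the budget `t^c + c` eventually exceeds the exact rank
(`≤ 2^{4t}`). [folklore] -/
theorem not_uniformT :
    ¬ (∃ δ : ℝ, 0 < δ ∧ δ < 1 ∧ ∃ t : ℕ, ∀ c : ℕ, ∀ r : ℕ, r ≤ t ^ c + c →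
        ∀ (a : Fin r → ℂ) (g : Fin r → QReg (t * 4) → ℂ), (∀ i, IsGaussian (g i)) →
          δ ^ 2 < normSq (magicMPow t - ∑ i, a i • g i)) := by
  rintro ⟨δ, -, -, t, h⟩
  obtain ⟨e, he⟩ := magicMPow_eq_sum_basis t
  have key := h (2 ^ (t * 4)) (2 ^ (t * 4)) (Nat.le_add_left _ _)
    (fun i => magicMPow t (e.symm i)) (fun i => basisState (e.symm i))
    (fun i => basisState_isGaussian _)
  rw [← he, sub_self, normSq_zero_vec] at key
  exact absurd key (not_lt.2 (sq_nonneg δ))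

/-- `∀ c ∀ t > 0` is false: `t = 1, c = 1, r = 2` (two basis states give `|M⟩` exactly). Any true
uniform-in-`t` version needs `t ≥ t₀(c)` with `2^{Θ(t₀)} > t₀^c` at least. [folklore] -/
theorem not_allPosT :
    ¬ (∃ δ : ℝ, 0 < δ ∧ δ < 1 ∧ ∀ c : ℕ, ∀ t : ℕ, 0 < t → ∀ r : ℕ, r ≤ t ^ c + c →
        ∀ (a : Fin r → ℂ) (g : Fin r → QReg (t * 4) → ℂ), (∀ i, IsGaussian (g i)) →
          δ ^ 2 < normSq (magicMPow t - ∑ i, a i • g i)) := by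
  rintro ⟨δ, -, -, h⟩
  exact no_witness_t_one δ 1 le_rfl (h 1 1 one_pos)

end Summit.QuantumAdvantage.QuantumAdvantage.Theorems.NegApproxGaussRankSuperpoly.Negative

end
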